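import Literature.NumberTheory.Sieve.FriedlanderIwaniecPrimesJacobiTwistedProp111Star
import HarnessLib

/-!
# Friedlander–Iwaniec, *The polynomial `X² + Y⁴` captures its primes*, §12: Proposition 11.1* in the
# printed (mixed-norm) form, on the reduced boxes `R < N r ≤ 2R`

[FI, §12, Proposition 11.1* and its proof, pp. 45–46 of arXiv:math/9811185; Ann. of Math. 148 (1998)
945–1040].  PROPOSITION 11.1*: "Let `m, D, R, S ≥ 1`. For any complex numbers `α_{rs}` and `β_{rs}`
supported in the box (11.6) we have
`∑_{D<d≤2D} |∑∑_{r₁s₂≡r₂s₁ (mod dm), (r₁,r₂)=1} α_{r₁s₁} β̄_{r₂s₂} (d/(r₁r₂))| ≤ 𝓜(mD,R,S)‖α‖‖β‖`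
where `𝓜(D,R,S) ≪ D^{-1/2}RS log 2R + (D√(RS) + RS^{3/4} + SR^{3/4})(RS)^ε`."  Printed proof, last
lines (p. 46): "Proposition 11.1 is applicable to `L(α, α)` giving
`L(α,α) ≪ {RS/(ρ√(mD)) + [mD√(RS) + RS^{3/4} + SR^{3/4}](RS)^ε} ∑_r ∑_s |α_{ρrs}|²`.  Similarly
`L(β, β)` […]. From these two estimates one arrives at Proposition 11.1* by summing over `ρ`."

WHY THIS FILE.  The tree's `exists_prop111Star_tau` (file `…Prop111Star`) states Proposition 11.1* with
BOTH terms against the divisor-weighted norms `(∑ τ(r)|α_{rs}|²)^{1/2}(∑ τ(r)|β_{rs}|²)^{1/2}` and no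
`log 2R`.  For the FIRST term this is too weak for (12.17)/(12.4): there the bound is summed over
`c = (r₁, r₂)` and `m ∣ c` with the weight `(cm)^{-1/2}` against `∑ |α_{crs}|²`, and
`∑_{c∣r} c^{-1/2} ∏_{p∣c}(1 + p^{-1/2}) ≤ τ(r)` for odd `r` is what makes (12.17) carry `τ(r)` and
(12.4) carry only `(log 2RS)⁴` on `D^{1/3}(RS)^{2/3}`; with `τ` already inside the norm the weight
becomes `τ(r) ∏_{p∣r}(1 + (p^{-1/2} + p^{-1})/2)`, which is not `O(τ(r) (log r)^A)`.  So the printed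
split treatment of the `ρ`-sum is needed: the term `RS/(ρ√(mD))` is summed with `∑_ρ ρ^{-1} ≤ log 2R`
against the PLAIN norms (`∑_{ρ∣r}|α_{rs}|² ≤ ‖α‖²`), and only the `ρ`-free terms (which carry `(RS)^ε`
and absorb divisor functions downstream) are summed by Cauchy's inequality into the `τ`-weighted norms.

Moreover, in (12.9)–(12.15) Proposition 11.1* is applied to the REDUCED variables `r/c`, which range over
`R/c < r ≤ 2R/c`, i.e. over `{r : R < c r ≤ 2R}` — not a box `(R', 2R']` with `R' ∈ ℕ`.  These reduced
boxes are stable under the substitution `r = ρ r'` of the printed proof (`{r' : R < cρ r' ≤ 2R}`), so we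
state and prove the proposition directly on them:

* `exists_prop111Star_mixed` — **Proposition 11.1\* (printed form, reduced boxes)**: for every
  `0 < ε ≤ 1` there is `C > 0` such that for all `m, D, S ≥ 1`, `1 ≤ N ≤ R`, and all `α, β` supported on
  odd `r` coprime to `m`, with `X = R/N` and all `r`-sums over `R < N r ≤ 2R`, `s`-sums over `S < s ≤ 2S`:
  `∑_{D<d≤2D} |∑_{r₁s₂≡r₂s₁ (dm), (r₁,r₂)=1} α_{r₁s₁} β̄_{r₂s₂} (d/(r₁r₂))|`
  `≤ C { XS (mD)^{-1/2} log(2R) ‖α‖‖β‖ + (mD√(XS) + XS^{3/4} + SX^{3/4})(XS)^ε (∑τ(r)|α_{rs}|²)^{1/2}(∑τ(r)|β_{rs}|²)^{1/2} }`.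
  (`N = 1` is the printed statement, with the `τ`-qualifier on the second term only — which is how the
  printed `‖α‖‖β‖ (RS)^ε` is to be read, `τ(r) ≪ r^ε`; cf. the tree's Prop. 13.1.)

Route (printed): Möbius in `(r₁,r₂)=1` (`∑_ρ μ(ρ) …`); for `Nρ ≤ R` the substitution `r = ρr'`
(`bilinearDvd_term_eq`: `(d/(ρ²r₁'r₂')) = (d/ρ)²(d/(r₁'r₂'))`, the congruence descends since
`(ρ, dm) = 1` on non-zero terms) turns the `ρ`-th term into `[(d,ρ)=1]·T_ρ(d)`, `T_ρ` the core form of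
`r' ↦ α_{ρr's}` on `R < Nρ r' ≤ 2R ⊆ (q, 4q]`, `q = ⌊R/(Nρ)⌋ ≥ 1`, bounded by the tree's
`exists_bilinearCongr_four_le` with box scale `q ≤ X/ρ` — this is the `ρ^{-1}`; for `Nρ > R` the `ρ`-th
term only sees `r₁ = r₂ = ρ` and is bounded by the same core bound on `(⌊X⌋, 4⌊X⌋]`, the sum over these
`ρ` being a single Cauchy–Schwarz `∑_ρ ‖α_{ρ·}‖‖β_{ρ·}‖ ≤ ‖α‖‖β‖`.  Harmonic sum
`∑_{ρ≤X} ρ^{-1} ≤ 1 + log R`, and `2 + log R ≤ 3 log 2R`.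

No definitions, no named facts.  (HOME/parity-ideate-lit/FI98-Prop121-MAP.md, step 1 / addendum (iv).)
-/

noncomputable section

open Finset Real Complex
open scoped NumberTheorySymbols ComplexConjugate ArithmeticFunction.Moebius
  ArithmeticFunction.sigma

namespace Literature.NumberTheory.Sieve.FriedlanderIwaniecPrimes

/-! ### Möbius inversion of `(r₁, r₂) = 1` on a general box `(A, B]` -/

/-- For `r₂ ∈ (A, B]`: `[(r₁, r₂) = 1] = ∑_{1 ≤ ρ ≤ B} μ(ρ) [ρ ∣ r₁] [ρ ∣ r₂]`. [folklore] -/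
private theorem ite_coprime_eq_sum_Icc' {A B r₁ r₂ : ℕ} (hr₂ : r₂ ∈ Ioc A B) :
    (if r₁.Coprime r₂ then (1 : ℂ) else 0) =
      ∑ ρ ∈ Icc 1 B, if ρ ∣ r₁ ∧ ρ ∣ r₂ then (μ ρ : ℂ) else 0 := by
  rw [mem_Ioc] at hr₂
  have hr0 : r₂ ≠ 0 := by omega
  rw [ite_coprime_eq_sum_filter_moebius r₁ hr0, ← sum_filter]
  refine sum_congr ?_ fun _ _ => rfl
  ext ρ
  simp only [mem_filter, Nat.mem_divisors, mem_Icc]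
  constructor
  · rintro ⟨⟨h2, -⟩, h1⟩
    exact ⟨⟨Nat.pos_of_dvd_of_pos h2 (by omega), (Nat.le_of_dvd (by omega) h2).trans hr₂.2⟩, h1, h2⟩
  · rintro ⟨-, h1, h2⟩
    exact ⟨⟨h2, hr0⟩, h1⟩

/-- Möbius inversion of `(r₁, r₂) = 1` in the bilinear form of Proposition 11.1*, `r`-variables in a
general box `(A, B]`:
`∑_{r₁s₂≡r₂s₁ (dm), (r₁,r₂)=1} α β̄ (d/(r₁r₂)) = ∑_{1≤ρ≤B} μ(ρ) ∑_{ρ∣r₁, ρ∣r₂, r₁s₂≡r₂s₁ (dm)} α β̄ (d/(r₁r₂))`.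
[cite: FriedlanderIwaniecAnnals1998, §12, proof of Proposition 11.1*] -/
theorem bilinearCoprime_eq_sum_moebius' (m d A B S : ℕ) (α β : ℕ → ℕ → ℂ) :
    (∑ r₁ ∈ Ioc A B, ∑ s₁ ∈ Ioc S (2 * S), ∑ r₂ ∈ Ioc A B, ∑ s₂ ∈ Ioc S (2 * S),
      if ((d * m : ℕ) : ℤ) ∣ (r₁ : ℤ) * s₂ - (r₂ : ℤ) * s₁ ∧ r₁.Coprime r₂ then
        α r₁ s₁ * conj (β r₂ s₂) * (J((d : ℤ) | r₁ * r₂) : ℂ) else 0) =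
    ∑ ρ ∈ Icc 1 B, (μ ρ : ℂ) *
      ∑ r₁ ∈ Ioc A B, ∑ s₁ ∈ Ioc S (2 * S), ∑ r₂ ∈ Ioc A B, ∑ s₂ ∈ Ioc S (2 * S),
        if ρ ∣ r₁ ∧ ρ ∣ r₂ then
          (if ((d * m : ℕ) : ℤ) ∣ (r₁ : ℤ) * s₂ - (r₂ : ℤ) * s₁ then
            α r₁ s₁ * conj (β r₂ s₂) * (J((d : ℤ) | r₁ * r₂) : ℂ) else 0) else 0 := by
  have hterm : ∀ r₁ ∈ Ioc A B, ∀ s₁ ∈ Ioc S (2 * S), ∀ r₂ ∈ Ioc A B, ∀ s₂ ∈ Ioc S (2 * S),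
      (if ((d * m : ℕ) : ℤ) ∣ (r₁ : ℤ) * s₂ - (r₂ : ℤ) * s₁ ∧ r₁.Coprime r₂ then
        α r₁ s₁ * conj (β r₂ s₂) * (J((d : ℤ) | r₁ * r₂) : ℂ) else 0) =
      ∑ ρ ∈ Icc 1 B, (μ ρ : ℂ) *
        (if ρ ∣ r₁ ∧ ρ ∣ r₂ then
          (if ((d * m : ℕ) : ℤ) ∣ (r₁ : ℤ) * s₂ - (r₂ : ℤ) * s₁ then
            α r₁ s₁ * conj (β r₂ s₂) * (J((d : ℤ) | r₁ * r₂) : ℂ) else 0) else 0) := by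
    intro r₁ _ s₁ _ r₂ hr₂ s₂ _
    have key : (if ((d * m : ℕ) : ℤ) ∣ (r₁ : ℤ) * s₂ - (r₂ : ℤ) * s₁ ∧ r₁.Coprime r₂ then
        α r₁ s₁ * conj (β r₂ s₂) * (J((d : ℤ) | r₁ * r₂) : ℂ) else 0) =
        (if r₁.Coprime r₂ then (1 : ℂ) else 0) *
          (if ((d * m : ℕ) : ℤ) ∣ (r₁ : ℤ) * s₂ - (r₂ : ℤ) * s₁ then
            α r₁ s₁ * conj (β r₂ s₂) * (J((d : ℤ) | r₁ * r₂) : ℂ) else 0) := by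
      by_cases hc : r₁.Coprime r₂
      · rw [if_pos hc, one_mul]
        simp only [ite_and, if_pos hc]
      · rw [if_neg hc, zero_mul, if_neg (fun h => hc h.2)]
    rw [key, ite_coprime_eq_sum_Icc' hr₂, sum_mul]
    refine sum_congr rfl fun ρ _ => ?_
    by_cases h : ρ ∣ r₁ ∧ ρ ∣ r₂ <;> simp [h]
  rw [sum_congr rfl fun r₁ hr₁ => sum_congr rfl fun s₁ hs₁ => sum_congr rfl fun r₂ hr₂ =>
    sum_congr rfl fun s₂ hs₂ => hterm r₁ hr₁ s₁ hs₁ r₂ hr₂ s₂ hs₂]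
  simp only [Finset.sum_comm (t := Icc 1 B), mul_sum]

/-! ### The substitution `r = ρ r'` on a general box -/

/-- The multiples of `ρ ≥ 1` in `(A, B]` are the `ρt`, `t ∈ (A/ρ, B/ρ]`. [folklore] -/
private theorem sum_Ioc_ite_dvd_eq' {M : Type*} [AddCommMonoid M] {ρ : ℕ} (hρ : 0 < ρ) (A B : ℕ)
    (F : ℕ → M) :
    (∑ r ∈ Ioc A B, if ρ ∣ r then F r else 0) = ∑ t ∈ Ioc (A / ρ) (B / ρ), F (ρ * t) := by
  rw [← sum_filter, filter_dvd_Ioc_eq_image hρ,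
    sum_image fun x _ y _ h => Nat.eq_of_mul_eq_mul_left hρ h]

/-- An odd multiple `ρt` coprime to `m`: `t` is odd and coprime to `m`. [folklore] -/
private theorem odd_coprime_of_mul' {ρ t m : ℕ} (ho : Odd (ρ * t)) (hc : (ρ * t).Coprime m) :
    Odd t ∧ t.Coprime m :=
  ⟨(Nat.odd_mul.mp ho).2, Nat.Coprime.coprime_dvd_left (dvd_mul_left t ρ) hc⟩

/-- **The `ρ`-th Möbius term is `[(d,ρ)=1] · T_ρ(d)`** on a general box `(A, B]`: `T_ρ(d)` is the
bilinear form (modulus `dm`, symbol `(d/(t₁t₂))`, no coprimality condition) of the vectors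
`t ↦ α_{ρt,s}`, `t ↦ β_{ρt,s}` on `(A/ρ, B/ρ]`; for `α, β` supported on odd `r` coprime to `m`, `ρ ≥ 1`.
[cite: FriedlanderIwaniecAnnals1998, §12, proof of Proposition 11.1*] -/
theorem bilinearDvd_eq_ite_coprime_mul' {m d ρ A B S : ℕ} (hρ : 0 < ρ) {α β : ℕ → ℕ → ℂ}
    (hα : ∀ r s, α r s ≠ 0 → Odd r ∧ r.Coprime m) (hβ : ∀ r s, β r s ≠ 0 → Odd r ∧ r.Coprime m) :
    (∑ r₁ ∈ Ioc A B, ∑ s₁ ∈ Ioc S (2 * S), ∑ r₂ ∈ Ioc A B, ∑ s₂ ∈ Ioc S (2 * S),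
      if ρ ∣ r₁ ∧ ρ ∣ r₂ then
        (if ((d * m : ℕ) : ℤ) ∣ (r₁ : ℤ) * s₂ - (r₂ : ℤ) * s₁ then
          α r₁ s₁ * conj (β r₂ s₂) * (J((d : ℤ) | r₁ * r₂) : ℂ) else 0) else 0) =
    if d.Coprime ρ then
      ∑ t₁ ∈ Ioc (A / ρ) (B / ρ), ∑ s₁ ∈ Ioc S (2 * S), ∑ t₂ ∈ Ioc (A / ρ) (B / ρ),
        ∑ s₂ ∈ Ioc S (2 * S),
        (if ((d * m : ℕ) : ℤ) ∣ (t₁ : ℤ) * s₂ - (t₂ : ℤ) * s₁ then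
          α (ρ * t₁) s₁ * conj (β (ρ * t₂) s₂) * (J((d : ℤ) | t₁ * t₂) : ℂ) else 0)
    else 0 := by
  have hsplit : ∀ r₁ s₁ r₂ s₂ : ℕ,
      (if ρ ∣ r₁ ∧ ρ ∣ r₂ then
        (if ((d * m : ℕ) : ℤ) ∣ (r₁ : ℤ) * s₂ - (r₂ : ℤ) * s₁ then
          α r₁ s₁ * conj (β r₂ s₂) * (J((d : ℤ) | r₁ * r₂) : ℂ) else 0) else 0) =
      if ρ ∣ r₁ then (if ρ ∣ r₂ then
        (if ((d * m : ℕ) : ℤ) ∣ (r₁ : ℤ) * s₂ - (r₂ : ℤ) * s₁ then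
          α r₁ s₁ * conj (β r₂ s₂) * (J((d : ℤ) | r₁ * r₂) : ℂ) else 0) else 0) else 0 := by
    intro r₁ s₁ r₂ s₂
    by_cases h1 : ρ ∣ r₁ <;> by_cases h2 : ρ ∣ r₂ <;> simp [h1, h2]
  simp_rw [hsplit]
  have hout : ∀ (c : Prop) [Decidable c] (T : Finset ℕ) (G : ℕ → ℂ),
      (∑ x ∈ T, if c then G x else 0) = if c then ∑ x ∈ T, G x else 0 := by
    intro c _ T G
    split_ifs <;> simp
  simp_rw [hout]
  rw [sum_Ioc_ite_dvd_eq' hρ]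
  simp_rw [sum_Ioc_ite_dvd_eq' hρ]
  have hterm := fun t₁ s₁ t₂ s₂ => bilinearDvd_term_eq (d := d) (ρ := ρ) hα hβ t₁ s₁ t₂ s₂
  by_cases hcop : d.Coprime ρ
  · rw [if_pos hcop]
    exact sum_congr rfl fun t₁ _ => sum_congr rfl fun s₁ _ => sum_congr rfl fun t₂ _ =>
      sum_congr rfl fun s₂ _ => by have h := hterm t₁ s₁ t₂ s₂; rw [if_pos hcop] at h; exact h
  · rw [if_neg hcop]
    exact sum_eq_zero fun t₁ _ => sum_eq_zero fun s₁ _ => sum_eq_zero fun t₂ _ =>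
      sum_eq_zero fun s₂ _ => by have h := hterm t₁ s₁ t₂ s₂; rw [if_neg hcop] at h; exact h

/-! ### The reduced boxes `R < M r ≤ 2R` and the core bound on them -/

/-- For `q = ⌊R/M⌋ ≥ 1`: `⌊2R/M⌋ ≤ 4q`, so `{r : R < Mr ≤ 2R} = (⌊R/M⌋, ⌊2R/M⌋] ⊆ (q, 4q]`. [folklore] -/
private theorem Ioc_div_subset' {R M : ℕ} (hM : 0 < M) (hq : 1 ≤ R / M) :
    Ioc (R / M) (2 * R / M) ⊆ Ioc (R / M) (2 * (2 * (R / M))) := by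
  intro t ht
  rw [mem_Ioc] at ht ⊢
  refine ⟨ht.1, ht.2.trans ?_⟩
  have h1 : R < M * (R / M + 1) := Nat.lt_mul_div_succ R hM
  have h2 : 2 * R < (2 * (R / M) + 2) * M := by nlinarith [h1]
  have h3 : 2 * R / M < 2 * (R / M) + 2 := (Nat.div_lt_iff_lt_mul hM).mpr h2
  omega

/-- Restricting a vector to the box, termwise (the core form only sees the box). [folklore] -/
private theorem restrict_term_eq (T : Finset ℕ) (d m : ℕ) (x y : ℕ → ℕ → ℂ) {r₁ r₂ : ℕ}
    (hr₁ : r₁ ∈ T) (hr₂ : r₂ ∈ T) (s₁ s₂ : ℕ) :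
    (if ((d * m : ℕ) : ℤ) ∣ (r₁ : ℤ) * s₂ - (r₂ : ℤ) * s₁ then
        x r₁ s₁ * conj (y r₂ s₂) * (J((d : ℤ) | r₁ * r₂) : ℂ) else 0) =
      (if ((d * m : ℕ) : ℤ) ∣ (r₁ : ℤ) * s₂ - (r₂ : ℤ) * s₁ then
        (fun r s => if r ∈ T then x r s else 0) r₁ s₁ *
          conj ((fun r s => if r ∈ T then y r s else 0) r₂ s₂) * (J((d : ℤ) | r₁ * r₂) : ℂ)
      else 0) := by
  simp only [if_pos hr₁, if_pos hr₂]

set_option maxHeartbeats 800000 in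
/-- **The core bound on a reduced box.**  For `M ≥ 1` with `q = ⌊R/M⌋ ≥ 1` and vectors `x, y`
supported on odd `r` coprime to `m`, the core bilinear form (modulus `dm`, symbol `(d/(r₁r₂))`, no
coprimality condition) with `r`-variables in `{r : R < Mr ≤ 2R}` satisfies
`∑_{D<d≤2D} |…| ≤ 8C (𝓜♭(mD,q,S) + 𝓜♭(mD,2q,S)) ‖x‖ ‖y‖` (norms over the reduced box), `C` the
constant of `exists_bilinearCongr_four_le` (hypothesis `h4`): the reduced box lies in `(q, 4q]`.
[cite: FriedlanderIwaniecAnnals1998, §12, proof of Proposition 11.1*] -/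
theorem sum_norm_coreForm_reduced_le {ε C : ℝ}
    (h4 : ∀ (m D R' S : ℕ) (α β : ℕ → ℕ → ℂ), 1 ≤ m → 1 ≤ D → 1 ≤ R' → 1 ≤ S →
      (∀ r s, α r s ≠ 0 → Odd r ∧ r.Coprime m) → (∀ r s, β r s ≠ 0 → Odd r ∧ r.Coprime m) →
      ∑ d ∈ Ioc D (2 * D), ‖∑ r₁ ∈ Ioc R' (2 * (2 * R')), ∑ s₁ ∈ Ioc S (2 * S),
          ∑ r₂ ∈ Ioc R' (2 * (2 * R')), ∑ s₂ ∈ Ioc S (2 * S),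
          (if ((d * m : ℕ) : ℤ) ∣ (r₁ : ℤ) * s₂ - (r₂ : ℤ) * s₁ then
            α r₁ s₁ * conj (β r₂ s₂) * (J((d : ℤ) | r₁ * r₂) : ℂ) else 0)‖ ≤
        8 * C * (((R' : ℝ) * S / Real.sqrt ((m : ℝ) * D) +
            ((m : ℝ) * D * Real.sqrt ((R' : ℝ) * S) + (R' : ℝ) * (S : ℝ) ^ (3 / 4 : ℝ) +
              (S : ℝ) * (R' : ℝ) ^ (3 / 4 : ℝ)) * ((R' : ℝ) * S) ^ ε) +
          (((2 * R' : ℕ) : ℝ) * S / Real.sqrt ((m : ℝ) * D) +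
            ((m : ℝ) * D * Real.sqrt (((2 * R' : ℕ) : ℝ) * S) +
              ((2 * R' : ℕ) : ℝ) * (S : ℝ) ^ (3 / 4 : ℝ) +
              (S : ℝ) * ((2 * R' : ℕ) : ℝ) ^ (3 / 4 : ℝ)) * (((2 * R' : ℕ) : ℝ) * S) ^ ε)) *
          (Real.sqrt (∑ r ∈ Ioc R' (2 * (2 * R')), ∑ s ∈ Ioc S (2 * S), ‖α r s‖ ^ 2) *
            Real.sqrt (∑ r ∈ Ioc R' (2 * (2 * R')), ∑ s ∈ Ioc S (2 * S), ‖β r s‖ ^ 2)))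
    {m D R S M : ℕ} (hm : 1 ≤ m) (hD : 1 ≤ D) (hS : 1 ≤ S) (hM : 0 < M) (hq : 1 ≤ R / M)
    {x y : ℕ → ℕ → ℂ}
    (hx : ∀ r s, x r s ≠ 0 → Odd r ∧ r.Coprime m) (hy : ∀ r s, y r s ≠ 0 → Odd r ∧ r.Coprime m) :
    ∑ d ∈ Ioc D (2 * D), ‖∑ r₁ ∈ Ioc (R / M) (2 * R / M), ∑ s₁ ∈ Ioc S (2 * S),
        ∑ r₂ ∈ Ioc (R / M) (2 * R / M), ∑ s₂ ∈ Ioc S (2 * S),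
        (if ((d * m : ℕ) : ℤ) ∣ (r₁ : ℤ) * s₂ - (r₂ : ℤ) * s₁ then
          x r₁ s₁ * conj (y r₂ s₂) * (J((d : ℤ) | r₁ * r₂) : ℂ) else 0)‖ ≤
      8 * C * ((((R / M : ℕ) : ℝ) * S / Real.sqrt ((m : ℝ) * D) +
          ((m : ℝ) * D * Real.sqrt (((R / M : ℕ) : ℝ) * S) +
            ((R / M : ℕ) : ℝ) * (S : ℝ) ^ (3 / 4 : ℝ) +
            (S : ℝ) * ((R / M : ℕ) : ℝ) ^ (3 / 4 : ℝ)) * (((R / M : ℕ) : ℝ) * S) ^ ε) +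
        (((2 * (R / M) : ℕ) : ℝ) * S / Real.sqrt ((m : ℝ) * D) +
          ((m : ℝ) * D * Real.sqrt (((2 * (R / M) : ℕ) : ℝ) * S) +
            ((2 * (R / M) : ℕ) : ℝ) * (S : ℝ) ^ (3 / 4 : ℝ) +
            (S : ℝ) * ((2 * (R / M) : ℕ) : ℝ) ^ (3 / 4 : ℝ)) * (((2 * (R / M) : ℕ) : ℝ) * S) ^ ε)) *
        (Real.sqrt (∑ r ∈ Ioc (R / M) (2 * R / M), ∑ s ∈ Ioc S (2 * S), ‖x r s‖ ^ 2) *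
          Real.sqrt (∑ r ∈ Ioc (R / M) (2 * R / M), ∑ s ∈ Ioc S (2 * S), ‖y r s‖ ^ 2)) := by
  classical
  set T : Finset ℕ := Ioc (R / M) (2 * R / M) with hT
  have hsub : T ⊆ Ioc (R / M) (2 * (2 * (R / M))) := Ioc_div_subset' hM hq
  set xT : ℕ → ℕ → ℂ := fun r s => if r ∈ T then x r s else 0 with hxT
  set yT : ℕ → ℕ → ℂ := fun r s => if r ∈ T then y r s else 0 with hyT
  have hx0 : ∀ r s, r ∉ T → xT r s = 0 := fun r s hr => by simp only [hxT, if_neg hr]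
  have hy0 : ∀ r s, r ∉ T → yT r s = 0 := fun r s hr => by simp only [hyT, if_neg hr]
  have hx1 : ∀ r s, r ∈ T → xT r s = x r s := fun r s hr => by simp only [hxT, if_pos hr]
  have hy1 : ∀ r s, r ∈ T → yT r s = y r s := fun r s hr => by simp only [hyT, if_pos hr]
  have hsuppx : ∀ r s, xT r s ≠ 0 → Odd r ∧ r.Coprime m := by
    intro r s h
    by_cases hr : r ∈ T
    · rw [hx1 r s hr] at h; exact hx r s h
    · exact absurd (hx0 r s hr) h
  have hsuppy : ∀ r s, yT r s ≠ 0 → Odd r ∧ r.Coprime m := by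
    intro r s h
    by_cases hr : r ∈ T
    · rw [hy1 r s hr] at h; exact hy r s h
    · exact absurd (hy0 r s hr) h
  have key := h4 m D (R / M) S xT yT hm hD hq hS hsuppx hsuppy
  have hinner : ∀ d : ℕ,
      (∑ r₁ ∈ T, ∑ s₁ ∈ Ioc S (2 * S), ∑ r₂ ∈ T, ∑ s₂ ∈ Ioc S (2 * S),
        (if ((d * m : ℕ) : ℤ) ∣ (r₁ : ℤ) * s₂ - (r₂ : ℤ) * s₁ then
          x r₁ s₁ * conj (y r₂ s₂) * (J((d : ℤ) | r₁ * r₂) : ℂ) else 0)) =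
      ∑ r₁ ∈ Ioc (R / M) (2 * (2 * (R / M))), ∑ s₁ ∈ Ioc S (2 * S),
        ∑ r₂ ∈ Ioc (R / M) (2 * (2 * (R / M))), ∑ s₂ ∈ Ioc S (2 * S),
        (if ((d * m : ℕ) : ℤ) ∣ (r₁ : ℤ) * s₂ - (r₂ : ℤ) * s₁ then
          xT r₁ s₁ * conj (yT r₂ s₂) * (J((d : ℤ) | r₁ * r₂) : ℂ) else 0) := by
    intro d
    symm
    refine (sum_subset hsub fun r₁ _ hr₁ => ?_).symm.trans (sum_congr rfl fun r₁ hr₁ => ?_)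
    · refine sum_eq_zero fun s₁ _ => sum_eq_zero fun r₂ _ => sum_eq_zero fun s₂ _ => ?_
      rw [hx0 r₁ s₁ hr₁]
      simp
    · refine sum_congr rfl fun s₁ _ => ?_
      refine (sum_subset hsub fun r₂ _ hr₂ => ?_).symm.trans (sum_congr rfl fun r₂ hr₂ => ?_)
      · refine sum_eq_zero fun s₂ _ => ?_
        rw [hy0 r₂ s₂ hr₂]
        simp
      · refine sum_congr rfl fun s₂ _ => ?_
        rw [hx1 r₁ s₁ hr₁, hy1 r₂ s₂ hr₂]
  have hnormx : ∑ r ∈ Ioc (R / M) (2 * (2 * (R / M))), ∑ s ∈ Ioc S (2 * S), ‖xT r s‖ ^ 2 =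
      ∑ r ∈ T, ∑ s ∈ Ioc S (2 * S), ‖x r s‖ ^ 2 := by
    refine (sum_subset hsub fun r _ hr => ?_).symm.trans (sum_congr rfl fun r hr => ?_)
    · exact sum_eq_zero fun s _ => by rw [hx0 r s hr]; simp
    · exact sum_congr rfl fun s _ => by rw [hx1 r s hr]
  have hnormy : ∑ r ∈ Ioc (R / M) (2 * (2 * (R / M))), ∑ s ∈ Ioc S (2 * S), ‖yT r s‖ ^ 2 =
      ∑ r ∈ T, ∑ s ∈ Ioc S (2 * S), ‖y r s‖ ^ 2 := by
    refine (sum_subset hsub fun r _ hr => ?_).symm.trans (sum_congr rfl fun r hr => ?_)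
    · exact sum_eq_zero fun s _ => by rw [hy0 r s hr]; simp
    · exact sum_congr rfl fun s _ => by rw [hy1 r s hr]
  rw [hnormx, hnormy] at key
  calc _ = _ := sum_congr rfl fun d _ => by rw [hinner d]
    _ ≤ _ := key


/-! ### Bookkeeping of the bound `𝓜♭(mD,q,S) + 𝓜♭(mD,2q,S)` in terms of the real box scale `X = R/N` -/

/-- The `ρ`-free part `T(Z) = (mD√(ZS) + ZS^{3/4} + SZ^{3/4})(ZS)^ε` is monotone in `Z ≥ 0`. [folklore] -/
private theorem T_mono {ε : ℝ} (hε : 0 ≤ ε) {m D S : ℕ} {Z Z' : ℝ} (hZ : 0 ≤ Z) (hZZ' : Z ≤ Z') :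
    ((m : ℝ) * D * Real.sqrt (Z * S) + Z * (S : ℝ) ^ (3 / 4 : ℝ) + (S : ℝ) * Z ^ (3 / 4 : ℝ)) *
        (Z * S) ^ ε ≤
      ((m : ℝ) * D * Real.sqrt (Z' * S) + Z' * (S : ℝ) ^ (3 / 4 : ℝ) + (S : ℝ) * Z' ^ (3 / 4 : ℝ)) *
        (Z' * S) ^ ε := by
  have hS : (0 : ℝ) ≤ S := Nat.cast_nonneg S
  have hZ' : 0 ≤ Z' := hZ.trans hZZ'
  have hZS : Z * S ≤ Z' * S := mul_le_mul_of_nonneg_right hZZ' hS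
  have hZS0 : 0 ≤ Z * S := mul_nonneg hZ hS
  have hmD : (0 : ℝ) ≤ (m : ℝ) * D := by positivity
  have h1 : (m : ℝ) * D * Real.sqrt (Z * S) ≤ (m : ℝ) * D * Real.sqrt (Z' * S) :=
    mul_le_mul_of_nonneg_left (Real.sqrt_le_sqrt hZS) hmD
  have h2 : Z * (S : ℝ) ^ (3 / 4 : ℝ) ≤ Z' * (S : ℝ) ^ (3 / 4 : ℝ) :=
    mul_le_mul_of_nonneg_right hZZ' (by positivity)
  have h3 : (S : ℝ) * Z ^ (3 / 4 : ℝ) ≤ (S : ℝ) * Z' ^ (3 / 4 : ℝ) :=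
    mul_le_mul_of_nonneg_left (Real.rpow_le_rpow hZ hZZ' (by norm_num)) hS
  have h4 : (Z * S) ^ ε ≤ (Z' * S) ^ ε := Real.rpow_le_rpow hZS0 hZS hε
  have hpos : 0 ≤ (m : ℝ) * D * Real.sqrt (Z' * S) + Z' * (S : ℝ) ^ (3 / 4 : ℝ) +
      (S : ℝ) * Z' ^ (3 / 4 : ℝ) :=
    add_nonneg (add_nonneg (mul_nonneg hmD (Real.sqrt_nonneg _)) (mul_nonneg hZ' (by positivity)))
      (mul_nonneg hS (Real.rpow_nonneg hZ' _))
  exact mul_le_mul (by linarith) h4 (Real.rpow_nonneg hZS0 ε) hpos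

/-- `T(2Z) ≤ 4 T(Z)` for `Z ≥ 0`, `0 ≤ ε ≤ 1`. [folklore] -/
private theorem T_two_mul_le {ε : ℝ} (hε1 : ε ≤ 1) {m D S : ℕ} {Z : ℝ} (hZ : 0 ≤ Z) :
    ((m : ℝ) * D * Real.sqrt (2 * Z * S) + 2 * Z * (S : ℝ) ^ (3 / 4 : ℝ) +
        (S : ℝ) * (2 * Z) ^ (3 / 4 : ℝ)) * (2 * Z * S) ^ ε ≤
      4 * (((m : ℝ) * D * Real.sqrt (Z * S) + Z * (S : ℝ) ^ (3 / 4 : ℝ) + (S : ℝ) * Z ^ (3 / 4 : ℝ)) *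
        (Z * S) ^ ε) := by
  have hS : (0 : ℝ) ≤ S := Nat.cast_nonneg S
  have hZS0 : 0 ≤ Z * S := mul_nonneg hZ hS
  have hmD : (0 : ℝ) ≤ (m : ℝ) * D := by positivity
  -- first factor: `≤ 2 ×`
  have h1 : (m : ℝ) * D * Real.sqrt (2 * Z * S) ≤ 2 * ((m : ℝ) * D * Real.sqrt (Z * S)) := by
    rw [show 2 * Z * S = 2 * (Z * S) by ring, Real.sqrt_mul' 2 hZS0]
    have h2 : Real.sqrt 2 ≤ 2 := by
      rw [show (2 : ℝ) = Real.sqrt 4 by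
        rw [show (4 : ℝ) = 2 ^ 2 by norm_num, Real.sqrt_sq (by norm_num : (0:ℝ) ≤ 2)]]
      exact Real.sqrt_le_sqrt (by norm_num)
    · calc (m : ℝ) * D * (Real.sqrt 2 * Real.sqrt (Z * S))
          ≤ (m : ℝ) * D * (2 * Real.sqrt (Z * S)) := by
            gcongr
        _ = 2 * ((m : ℝ) * D * Real.sqrt (Z * S)) := by ring
  have h3 : (S : ℝ) * (2 * Z) ^ (3 / 4 : ℝ) ≤ 2 * ((S : ℝ) * Z ^ (3 / 4 : ℝ)) := by
    rw [Real.mul_rpow (by norm_num) hZ]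
    have h24 : (2 : ℝ) ^ (3 / 4 : ℝ) ≤ 2 := by
      calc (2 : ℝ) ^ (3 / 4 : ℝ) ≤ (2 : ℝ) ^ (1 : ℝ) :=
            Real.rpow_le_rpow_of_exponent_le (by norm_num) (by norm_num)
        _ = 2 := Real.rpow_one 2
    calc (S : ℝ) * ((2 : ℝ) ^ (3 / 4 : ℝ) * Z ^ (3 / 4 : ℝ))
        ≤ (S : ℝ) * (2 * Z ^ (3 / 4 : ℝ)) := by gcongr
      _ = 2 * ((S : ℝ) * Z ^ (3 / 4 : ℝ)) := by ring
  have hfac : (m : ℝ) * D * Real.sqrt (2 * Z * S) + 2 * Z * (S : ℝ) ^ (3 / 4 : ℝ) +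
      (S : ℝ) * (2 * Z) ^ (3 / 4 : ℝ) ≤
      2 * ((m : ℝ) * D * Real.sqrt (Z * S) + Z * (S : ℝ) ^ (3 / 4 : ℝ) +
        (S : ℝ) * Z ^ (3 / 4 : ℝ)) := by nlinarith [h1, h3]
  have hpow : (2 * Z * S) ^ ε ≤ 2 * (Z * S) ^ ε := by
    rw [show 2 * Z * S = 2 * (Z * S) by ring, Real.mul_rpow (by norm_num) hZS0]
    have h2e : (2 : ℝ) ^ ε ≤ 2 := by
      calc (2 : ℝ) ^ ε ≤ (2 : ℝ) ^ (1 : ℝ) := Real.rpow_le_rpow_of_exponent_le (by norm_num) hε1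
        _ = 2 := Real.rpow_one 2
    exact mul_le_mul_of_nonneg_right h2e (Real.rpow_nonneg hZS0 ε)
  have hT0 : 0 ≤ (m : ℝ) * D * Real.sqrt (Z * S) + Z * (S : ℝ) ^ (3 / 4 : ℝ) +
      (S : ℝ) * Z ^ (3 / 4 : ℝ) := by positivity
  have hfac0 : 0 ≤ (m : ℝ) * D * Real.sqrt (2 * Z * S) + 2 * Z * (S : ℝ) ^ (3 / 4 : ℝ) +
      (S : ℝ) * (2 * Z) ^ (3 / 4 : ℝ) := by positivity
  calc _ ≤ (2 * ((m : ℝ) * D * Real.sqrt (Z * S) + Z * (S : ℝ) ^ (3 / 4 : ℝ) +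
        (S : ℝ) * Z ^ (3 / 4 : ℝ))) * (2 * (Z * S) ^ ε) :=
        mul_le_mul hfac hpow (Real.rpow_nonneg (by positivity) ε) (by positivity)
    _ = _ := by ring

/-- **`𝓜♭(mD,q,S) + 𝓜♭(mD,2q,S) ≤ 3 YS/√(mD) + 5 T(X)`** for `1 ≤ q ≤ Y ≤ X` (real `Y, X`),
`0 ≤ ε ≤ 1`: the box-scale bookkeeping after the substitution `r = ρr'` (`q = ⌊R/(Nρ)⌋`, `Y = X/ρ`,
`X = R/N`). [folklore] -/
private theorem flat_two_boxes_le {ε : ℝ} (hε : 0 ≤ ε) (hε1 : ε ≤ 1) {m D S q : ℕ} {Y X : ℝ}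
    (hqY : (q : ℝ) ≤ Y) (hYX : Y ≤ X) :
    (((q : ℕ) : ℝ) * S / Real.sqrt ((m : ℝ) * D) +
          ((m : ℝ) * D * Real.sqrt (((q : ℕ) : ℝ) * S) +
            ((q : ℕ) : ℝ) * (S : ℝ) ^ (3 / 4 : ℝ) +
            (S : ℝ) * ((q : ℕ) : ℝ) ^ (3 / 4 : ℝ)) * ((((q : ℕ) : ℝ)) * S) ^ ε) +
        (((2 * q : ℕ) : ℝ) * S / Real.sqrt ((m : ℝ) * D) +
          ((m : ℝ) * D * Real.sqrt (((2 * q : ℕ) : ℝ) * S) +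
            ((2 * q : ℕ) : ℝ) * (S : ℝ) ^ (3 / 4 : ℝ) +
            (S : ℝ) * ((2 * q : ℕ) : ℝ) ^ (3 / 4 : ℝ)) * (((2 * q : ℕ) : ℝ) * S) ^ ε) ≤
      3 * (Y * S / Real.sqrt ((m : ℝ) * D)) +
        5 * (((m : ℝ) * D * Real.sqrt (X * S) + X * (S : ℝ) ^ (3 / 4 : ℝ) +
          (S : ℝ) * X ^ (3 / 4 : ℝ)) * (X * S) ^ ε) := by
  have hq0 : (0 : ℝ) ≤ q := Nat.cast_nonneg q
  have hY0 : 0 ≤ Y := hq0.trans hqY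
  have hX0 : 0 ≤ X := hY0.trans hYX
  have hS : (0 : ℝ) ≤ S := Nat.cast_nonneg S
  have hsq : 0 ≤ Real.sqrt ((m : ℝ) * D) := Real.sqrt_nonneg _
  have h2q : ((2 * q : ℕ) : ℝ) = 2 * (q : ℝ) := by push_cast; ring
  rw [h2q]
  -- the `A`-parts
  have hA1 : (q : ℝ) * S / Real.sqrt ((m : ℝ) * D) ≤ Y * S / Real.sqrt ((m : ℝ) * D) := by
    gcongr
  have hA2 : 2 * (q : ℝ) * S / Real.sqrt ((m : ℝ) * D) ≤ 2 * (Y * S / Real.sqrt ((m : ℝ) * D)) := by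
    rw [show 2 * (q : ℝ) * S / Real.sqrt ((m : ℝ) * D) = 2 * ((q : ℝ) * S / Real.sqrt ((m : ℝ) * D))
      by ring]
    gcongr
  -- the `T`-parts
  have hT1 := T_mono (m := m) (D := D) (S := S) hε hq0 (hqY.trans hYX)
  have hT2 : ((m : ℝ) * D * Real.sqrt (2 * (q : ℝ) * S) + 2 * (q : ℝ) * (S : ℝ) ^ (3 / 4 : ℝ) +
        (S : ℝ) * (2 * (q : ℝ)) ^ (3 / 4 : ℝ)) * (2 * (q : ℝ) * S) ^ ε ≤
      4 * (((m : ℝ) * D * Real.sqrt (X * S) + X * (S : ℝ) ^ (3 / 4 : ℝ) +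
        (S : ℝ) * X ^ (3 / 4 : ℝ)) * (X * S) ^ ε) :=
    (T_two_mul_le (m := m) (D := D) (S := S) hε1 hq0).trans (by linarith [hT1])
  have hTX0 : 0 ≤ ((m : ℝ) * D * Real.sqrt (X * S) + X * (S : ℝ) ^ (3 / 4 : ℝ) +
      (S : ℝ) * X ^ (3 / 4 : ℝ)) * (X * S) ^ ε := by positivity
  linarith [hA1, hA2, hT1, hT2]

/-! ### Divisor-sum bookkeeping -/

/-- `∑_{1≤ρ≤B} ∑_{r ∈ (A,B], ρ∣r} g(r) = ∑_{r ∈ (A,B]} τ(r) g(r)`. [folklore] -/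
private theorem sum_Icc_sum_ite_dvd_eq' (A B : ℕ) (g : ℕ → ℝ) :
    ∑ ρ ∈ Icc 1 B, ∑ r ∈ Ioc A B, (if ρ ∣ r then g r else 0) =
      ∑ r ∈ Ioc A B, (σ 0 r : ℝ) * g r := by
  rw [sum_comm]
  refine sum_congr rfl fun r hr => ?_
  rw [mem_Ioc] at hr
  have hset : (Icc 1 B).filter (· ∣ r) = r.divisors := by
    ext ρ
    simp only [mem_filter, mem_Icc, Nat.mem_divisors]
    constructor
    · rintro ⟨-, h2⟩
      exact ⟨h2, by omega⟩
    · rintro ⟨h2, -⟩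
      exact ⟨⟨Nat.pos_of_dvd_of_pos h2 (by omega), (Nat.le_of_dvd (by omega) h2).trans hr.2⟩, h2⟩
  rw [← sum_filter, sum_const, nsmul_eq_mul, hset, ArithmeticFunction.sigma_zero_apply]

/-- `H_n ≤ 1 + log n` over `Icc 1 n` (Mathlib's `harmonic_le_one_add_log`). [folklore] -/
private theorem sum_Icc_inv_le_log' (n : ℕ) (hn : 1 ≤ n) :
    ∑ s ∈ Icc 1 n, ((s : ℝ))⁻¹ ≤ 1 + Real.log n := by
  have h := harmonic_le_one_add_log n
  have _ := hn
  simpa [harmonic_eq_sum_Icc, Rat.cast_sum, Rat.cast_inv, Rat.cast_natCast] using h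

/-- `2 + log R ≤ 3 log(2R)` for `R ≥ 1`. [folklore] -/
private theorem two_add_log_le {R : ℕ} (hR : 1 ≤ R) :
    2 + Real.log R ≤ 3 * Real.log (2 * R) := by
  have hR0 : (0 : ℝ) < R := by exact_mod_cast hR
  rw [Real.log_mul (by norm_num) hR0.ne']
  have hlog2 : (0.6931471803 : ℝ) < Real.log 2 := Real.log_two_gt_d9
  have hlogR : 0 ≤ Real.log R := Real.log_nonneg (by exact_mod_cast hR)
  linarith


/-- Restricting the vectors to the multiples of `ρ`, termwise. [folklore] -/
private theorem ite_dvd_term_eq' (ρ d m : ℕ) (α β : ℕ → ℕ → ℂ) (r₁ s₁ r₂ s₂ : ℕ) :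
    (if ρ ∣ r₁ ∧ ρ ∣ r₂ then
      (if ((d * m : ℕ) : ℤ) ∣ (r₁ : ℤ) * s₂ - (r₂ : ℤ) * s₁ then
        α r₁ s₁ * conj (β r₂ s₂) * (J((d : ℤ) | r₁ * r₂) : ℂ) else 0) else 0) =
    (if ((d * m : ℕ) : ℤ) ∣ (r₁ : ℤ) * s₂ - (r₂ : ℤ) * s₁ then
      (if ρ ∣ r₁ then α r₁ s₁ else 0) * conj (if ρ ∣ r₂ then β r₂ s₂ else 0) *
        (J((d : ℤ) | r₁ * r₂) : ℂ) else 0) := by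
  by_cases h1 : ρ ∣ r₁ <;> by_cases h2 : ρ ∣ r₂ <;> simp [h1, h2]

/-- In the reduced box `R < N r ≤ 2R`, a multiple of `ρ` with `Nρ > R` is `ρ` itself. [folklore] -/
private theorem eq_of_dvd_of_mem_box {R N ρ r : ℕ} (hρ : ¬N * ρ ≤ R)
    (hr : r ∈ Ioc (R / N) (2 * R / N)) (hdvd : ρ ∣ r) : r = ρ := by
  rw [mem_Ioc] at hr
  obtain ⟨k, rfl⟩ := hdvd
  have h2 : N * (ρ * k) ≤ 2 * R := by
    have := Nat.mul_div_le (2 * R) N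
    calc N * (ρ * k) ≤ N * (2 * R / N) := Nat.mul_le_mul_left _ hr.2
      _ ≤ 2 * R := this
  have hk0 : k ≠ 0 := by
    rintro rfl
    simp at hr
  have hk1 : k = 1 := by
    by_contra hk1
    have hk2 : 2 ≤ k := by omega
    have : 2 * (N * ρ) ≤ N * (ρ * k) := by
      rw [show N * (ρ * k) = (N * ρ) * k by ring]
      exact Nat.mul_comm 2 (N * ρ) ▸ Nat.mul_le_mul_left (N * ρ) hk2
    omega
  rw [hk1, mul_one]

set_option maxHeartbeats 1600000 in
/-- **Proposition 11.1\* (printed, mixed-norm form) on the reduced boxes `R < N r ≤ 2R`.**  For every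
`0 < ε ≤ 1` there is `C > 0` such that for all `m, D, S ≥ 1`, `1 ≤ N ≤ R`, and all `α_{rs}, β_{rs}`
supported on odd `r` coprime to `m`, with `X = R/N` and the `r`-variables summed over
`{r : R < N r ≤ 2R} = (⌊R/N⌋, ⌊2R/N⌋]`, `s` over `(S, 2S]`:
`∑_{D<d≤2D} |∑_{r₁s₂ ≡ r₂s₁ (mod dm), (r₁,r₂)=1} α_{r₁s₁} β̄_{r₂s₂} (d/(r₁r₂))|`
`≤ C { XS (mD)^{-1/2} log(2R) ‖α‖‖β‖ + (mD√(XS) + XS^{3/4} + SX^{3/4})(XS)^ε (∑τ(r)|α_{rs}|²)^{1/2} (∑τ(r)|β_{rs}|²)^{1/2} }`.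
For `N = 1` this is the printed Proposition 11.1* (`𝓜(mD,R,S) ≪ (mD)^{-1/2}RS log 2R + …`), the
`τ`-qualifier sitting on the `(RS)^ε`-terms only; general `N` is the form applied in (12.15) to the
variables reduced by `c = (r₁, r₂)` (box `R/c < r ≤ 2R/c`).  Hypotheses as used by the printed proof
("note that `(r₁r₂, m) = 1`"; (12.1)).
[cite: FriedlanderIwaniecAnnals1998, Proposition 11.1* (§12, pp. 45–46)] -/
theorem exists_prop111Star_mixed {ε : ℝ} (hε : 0 < ε) (hε1 : ε ≤ 1) :
    ∃ C : ℝ, 0 < C ∧ ∀ (m D R S N : ℕ) (α β : ℕ → ℕ → ℂ), 1 ≤ m → 1 ≤ D → 1 ≤ S → 1 ≤ N →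
      N ≤ R →
      (∀ r s, α r s ≠ 0 → Odd r ∧ r.Coprime m) → (∀ r s, β r s ≠ 0 → Odd r ∧ r.Coprime m) →
      ∑ d ∈ Ioc D (2 * D), ‖∑ r₁ ∈ Ioc (R / N) (2 * R / N), ∑ s₁ ∈ Ioc S (2 * S),
          ∑ r₂ ∈ Ioc (R / N) (2 * R / N), ∑ s₂ ∈ Ioc S (2 * S),
          (if ((d * m : ℕ) : ℤ) ∣ (r₁ : ℤ) * s₂ - (r₂ : ℤ) * s₁ ∧ r₁.Coprime r₂ then
            α r₁ s₁ * conj (β r₂ s₂) * (J((d : ℤ) | r₁ * r₂) : ℂ) else 0)‖ ≤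
        C * ((R : ℝ) / N * S / Real.sqrt ((m : ℝ) * D) * Real.log (2 * R) *
            (Real.sqrt (∑ r ∈ Ioc (R / N) (2 * R / N), ∑ s ∈ Ioc S (2 * S), ‖α r s‖ ^ 2) *
              Real.sqrt (∑ r ∈ Ioc (R / N) (2 * R / N), ∑ s ∈ Ioc S (2 * S), ‖β r s‖ ^ 2)) +
          ((m : ℝ) * D * Real.sqrt ((R : ℝ) / N * S) + (R : ℝ) / N * (S : ℝ) ^ (3 / 4 : ℝ) +
              (S : ℝ) * ((R : ℝ) / N) ^ (3 / 4 : ℝ)) * ((R : ℝ) / N * S) ^ ε *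
            (Real.sqrt (∑ r ∈ Ioc (R / N) (2 * R / N), ∑ s ∈ Ioc S (2 * S),
                (σ 0 r : ℝ) * ‖α r s‖ ^ 2) *
              Real.sqrt (∑ r ∈ Ioc (R / N) (2 * R / N), ∑ s ∈ Ioc S (2 * S),
                (σ 0 r : ℝ) * ‖β r s‖ ^ 2))) := by
  obtain ⟨C, hC, h4⟩ := exists_bilinearCongr_four_le hε
  refine ⟨80 * C, by positivity, fun m D R S N α β hm hD hS hN hNR hα hβ => ?_⟩
  classical
  have hN0 : 0 < N := hN
  have hR : 1 ≤ R := hN.trans hNR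
  have hq₀ : 1 ≤ R / N := Nat.div_pos hNR hN0
  -- abbreviations
  set B : ℕ := 2 * R / N with hB
  set X : ℝ := (R : ℝ) / N with hX
  have hX0 : 0 ≤ X := by positivity
  set A : ℝ := X * S / Real.sqrt ((m : ℝ) * D) with hA
  set T : ℝ := ((m : ℝ) * D * Real.sqrt (X * S) + X * (S : ℝ) ^ (3 / 4 : ℝ) +
      (S : ℝ) * X ^ (3 / 4 : ℝ)) * (X * S) ^ ε with hT
  have hA0 : 0 ≤ A := by positivity
  have hT0 : 0 ≤ T := by positivity
  set gα : ℕ → ℝ := fun r => ∑ s ∈ Ioc S (2 * S), ‖α r s‖ ^ 2 with hgα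
  set gβ : ℕ → ℝ := fun r => ∑ s ∈ Ioc S (2 * S), ‖β r s‖ ^ 2 with hgβ
  have hgα0 : ∀ r, 0 ≤ gα r := fun r => sum_nonneg fun _ _ => by positivity
  have hgβ0 : ∀ r, 0 ≤ gβ r := fun r => sum_nonneg fun _ _ => by positivity
  set a : ℕ → ℝ := fun ρ => ∑ r ∈ Ioc (R / N) B, if ρ ∣ r then gα r else 0 with ha
  set b : ℕ → ℝ := fun ρ => ∑ r ∈ Ioc (R / N) B, if ρ ∣ r then gβ r else 0 with hb
  have ha0 : ∀ ρ, 0 ≤ a ρ := fun ρ => sum_nonneg fun r _ => by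
    split_ifs; exacts [hgα0 r, le_rfl]
  have hb0 : ∀ ρ, 0 ≤ b ρ := fun ρ => sum_nonneg fun r _ => by
    split_ifs; exacts [hgβ0 r, le_rfl]
  set nα : ℝ := ∑ r ∈ Ioc (R / N) B, gα r with hnα
  set nβ : ℝ := ∑ r ∈ Ioc (R / N) B, gβ r with hnβ
  set tα : ℝ := ∑ r ∈ Ioc (R / N) B, ∑ s ∈ Ioc S (2 * S), (σ 0 r : ℝ) * ‖α r s‖ ^ 2 with htα
  set tβ : ℝ := ∑ r ∈ Ioc (R / N) B, ∑ s ∈ Ioc S (2 * S), (σ 0 r : ℝ) * ‖β r s‖ ^ 2 with htβ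
  have htα' : tα = ∑ r ∈ Ioc (R / N) B, (σ 0 r : ℝ) * gα r := by
    simp only [htα, hgα, mul_sum]
  have htβ' : tβ = ∑ r ∈ Ioc (R / N) B, (σ 0 r : ℝ) * gβ r := by
    simp only [htβ, hgβ, mul_sum]
  -- `a ρ ≤ ‖α‖²`, `∑_ρ a ρ = ∑ τ |α|²`, `‖α‖² ≤ ∑ τ|α|²`
  have ha_le : ∀ ρ, a ρ ≤ nα := fun ρ => sum_le_sum fun r _ => by
    split_ifs; exacts [le_rfl, hgα0 r]
  have hb_le : ∀ ρ, b ρ ≤ nβ := fun ρ => sum_le_sum fun r _ => by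
    split_ifs; exacts [le_rfl, hgβ0 r]
  have ha_sum : ∑ ρ ∈ Icc 1 B, a ρ = tα := by rw [htα']; exact sum_Icc_sum_ite_dvd_eq' _ _ _
  have hb_sum : ∑ ρ ∈ Icc 1 B, b ρ = tβ := by rw [htβ']; exact sum_Icc_sum_ite_dvd_eq' _ _ _
  have hσ1 : ∀ r ∈ Ioc (R / N) B, (1 : ℝ) ≤ (σ 0 r : ℝ) := by
    intro r hr
    rw [mem_Ioc] at hr
    rw [ArithmeticFunction.sigma_zero_apply]
    exact_mod_cast Finset.card_pos.2 (Nat.nonempty_divisors.2 (by omega))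
  have hnt_α : nα ≤ tα := by
    rw [htα']
    exact sum_le_sum fun r hr => le_mul_of_one_le_left (hgα0 r) (hσ1 r hr)
  have hnt_β : nβ ≤ tβ := by
    rw [htβ']
    exact sum_le_sum fun r hr => le_mul_of_one_le_left (hgβ0 r) (hσ1 r hr)
  have hnα0 : 0 ≤ nα := sum_nonneg fun r _ => hgα0 r
  have hnβ0 : 0 ≤ nβ := sum_nonneg fun r _ => hgβ0 r
  -- the ρ-th Möbius term
  set F : ℕ → ℕ → ℂ := fun ρ d => ∑ r₁ ∈ Ioc (R / N) B, ∑ s₁ ∈ Ioc S (2 * S),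
      ∑ r₂ ∈ Ioc (R / N) B, ∑ s₂ ∈ Ioc S (2 * S),
      if ρ ∣ r₁ ∧ ρ ∣ r₂ then
        (if ((d * m : ℕ) : ℤ) ∣ (r₁ : ℤ) * s₂ - (r₂ : ℤ) * s₁ then
          α r₁ s₁ * conj (β r₂ s₂) * (J((d : ℤ) | r₁ * r₂) : ℂ) else 0) else 0 with hF
  /- Case (a): `Nρ ≤ R` — substitution `r = ρ r'`, core bound on the box reduced by `Nρ`,
  box scale `⌊R/(Nρ)⌋ ≤ X/ρ`. -/
  have hcaseA : ∀ ρ ∈ Icc 1 B, N * ρ ≤ R →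
      ∑ d ∈ Ioc D (2 * D), ‖F ρ d‖ ≤
        8 * C * (3 * (A / ρ) + 5 * T) * (Real.sqrt (a ρ) * Real.sqrt (b ρ)) := by
    intro ρ hρ hNρ
    rw [mem_Icc] at hρ
    have hρ0 : 0 < ρ := hρ.1
    have hM : 0 < N * ρ := Nat.mul_pos hN0 hρ0
    have hq : 1 ≤ R / (N * ρ) := Nat.div_pos hNρ hM
    -- support of the substituted vectors
    have hx : ∀ r s, (fun t s => α (ρ * t) s) r s ≠ 0 → Odd r ∧ r.Coprime m := fun t s h =>
      odd_coprime_of_mul' (hα _ _ h).1 (hα _ _ h).2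
    have hy : ∀ r s, (fun t s => β (ρ * t) s) r s ≠ 0 → Odd r ∧ r.Coprime m := fun t s h =>
      odd_coprime_of_mul' (hβ _ _ h).1 (hβ _ _ h).2
    have key := sum_norm_coreForm_reduced_le (ε := ε) h4 hm hD hS hM hq hx hy
    -- the box identities `(R/N)/ρ = R/(Nρ)`, `(2R/N)/ρ = 2R/(Nρ)`
    have hd1 : R / N / ρ = R / (N * ρ) := Nat.div_div_eq_div_mul R N ρ
    have hd2 : B / ρ = 2 * R / (N * ρ) := by rw [hB]; exact Nat.div_div_eq_div_mul _ N ρ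
    -- `F ρ d = [(d,ρ)=1] T_ρ(d)`
    have hF' : ∀ d, ‖F ρ d‖ ≤ ‖∑ t₁ ∈ Ioc (R / (N * ρ)) (2 * R / (N * ρ)), ∑ s₁ ∈ Ioc S (2 * S),
        ∑ t₂ ∈ Ioc (R / (N * ρ)) (2 * R / (N * ρ)), ∑ s₂ ∈ Ioc S (2 * S),
        (if ((d * m : ℕ) : ℤ) ∣ (t₁ : ℤ) * s₂ - (t₂ : ℤ) * s₁ then
          α (ρ * t₁) s₁ * conj (β (ρ * t₂) s₂) * (J((d : ℤ) | t₁ * t₂) : ℂ) else 0)‖ := by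
      intro d
      have h := bilinearDvd_eq_ite_coprime_mul' (m := m) (d := d) (A := R / N) (B := B) (S := S)
        hρ0 hα hβ
      rw [hd1, hd2] at h
      simp only [hF]
      rw [h]
      split_ifs
      · exact le_rfl
      · rw [norm_zero]; exact norm_nonneg _
    -- the norms of the substituted vectors are `a ρ`, `b ρ`
    have hna : ∑ r ∈ Ioc (R / (N * ρ)) (2 * R / (N * ρ)), ∑ s ∈ Ioc S (2 * S),
        ‖(fun t s => α (ρ * t) s) r s‖ ^ 2 = a ρ := by
      simp only [ha, hgα]
      rw [sum_Ioc_ite_dvd_eq' hρ0, hd1, hd2]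
    have hnb : ∑ r ∈ Ioc (R / (N * ρ)) (2 * R / (N * ρ)), ∑ s ∈ Ioc S (2 * S),
        ‖(fun t s => β (ρ * t) s) r s‖ ^ 2 = b ρ := by
      simp only [hb, hgβ]
      rw [sum_Ioc_ite_dvd_eq' hρ0, hd1, hd2]
    rw [hna, hnb] at key
    -- box-scale bookkeeping
    have hqY : ((R / (N * ρ) : ℕ) : ℝ) ≤ X / ρ := by
      calc ((R / (N * ρ) : ℕ) : ℝ) ≤ (R : ℝ) / ((N * ρ : ℕ) : ℝ) := Nat.cast_div_le
        _ = X / ρ := by rw [hX, Nat.cast_mul, div_div]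
    have hYX : X / ρ ≤ X := div_le_self hX0 (by exact_mod_cast hρ.1)
    have hflat := flat_two_boxes_le (m := m) (D := D) (S := S) hε.le hε1 hqY hYX
    have hsq0 : 0 ≤ Real.sqrt (a ρ) * Real.sqrt (b ρ) := mul_nonneg (Real.sqrt_nonneg _) (Real.sqrt_nonneg _)
    have hC8 : 0 ≤ 8 * C := by positivity
    calc ∑ d ∈ Ioc D (2 * D), ‖F ρ d‖
        ≤ ∑ d ∈ Ioc D (2 * D), ‖∑ t₁ ∈ Ioc (R / (N * ρ)) (2 * R / (N * ρ)),
            ∑ s₁ ∈ Ioc S (2 * S), ∑ t₂ ∈ Ioc (R / (N * ρ)) (2 * R / (N * ρ)),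
            ∑ s₂ ∈ Ioc S (2 * S),
            (if ((d * m : ℕ) : ℤ) ∣ (t₁ : ℤ) * s₂ - (t₂ : ℤ) * s₁ then
              α (ρ * t₁) s₁ * conj (β (ρ * t₂) s₂) * (J((d : ℤ) | t₁ * t₂) : ℂ) else 0)‖ :=
          sum_le_sum fun d _ => hF' d
      _ ≤ _ := key
      _ ≤ 8 * C * (3 * (X / ρ * S / Real.sqrt ((m : ℝ) * D)) + 5 * T) *
            (Real.sqrt (a ρ) * Real.sqrt (b ρ)) := by
          apply mul_le_mul_of_nonneg_right _ hsq0
          exact mul_le_mul_of_nonneg_left hflat hC8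
      _ = 8 * C * (3 * (A / ρ) + 5 * T) * (Real.sqrt (a ρ) * Real.sqrt (b ρ)) := by
          rw [hA]; ring
  /- Case (b): `Nρ > R` — only `r₁ = r₂ = ρ` survives; core bound on the box reduced by `N`. -/
  have hcaseB : ∀ ρ ∈ Icc 1 B, ¬N * ρ ≤ R →
      ∑ d ∈ Ioc D (2 * D), ‖F ρ d‖ ≤
        8 * C * (3 * A + 5 * T) * (Real.sqrt (a ρ) * Real.sqrt (b ρ)) := by
    intro ρ hρ hNρ
    set αρ : ℕ → ℕ → ℂ := fun r s => if ρ ∣ r then α r s else 0 with hαρ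
    set βρ : ℕ → ℕ → ℂ := fun r s => if ρ ∣ r then β r s else 0 with hβρ
    have hsupp : ∀ (x : ℕ → ℕ → ℂ), (∀ r s, x r s ≠ 0 → Odd r ∧ r.Coprime m) →
        ∀ r s, (if ρ ∣ r then x r s else 0) ≠ 0 → Odd r ∧ r.Coprime m := by
      intro x hx' r s h
      by_cases hr : ρ ∣ r
      · rw [if_pos hr] at h; exact hx' r s h
      · rw [if_neg hr] at h; exact absurd rfl h
    have key := sum_norm_coreForm_reduced_le (ε := ε) h4 hm hD hS hN0 hq₀ (hsupp α hα) (hsupp β hβ)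
    have hFeq : ∀ d, F ρ d = ∑ r₁ ∈ Ioc (R / N) (2 * R / N), ∑ s₁ ∈ Ioc S (2 * S),
        ∑ r₂ ∈ Ioc (R / N) (2 * R / N), ∑ s₂ ∈ Ioc S (2 * S),
        (if ((d * m : ℕ) : ℤ) ∣ (r₁ : ℤ) * s₂ - (r₂ : ℤ) * s₁ then
          (fun r s => if ρ ∣ r then α r s else 0) r₁ s₁ *
            conj ((fun r s => if ρ ∣ r then β r s else 0) r₂ s₂) *
            (J((d : ℤ) | r₁ * r₂) : ℂ) else 0) := fun d =>
      sum_congr rfl fun r₁ _ => sum_congr rfl fun s₁ _ => sum_congr rfl fun r₂ _ =>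
        sum_congr rfl fun s₂ _ => ite_dvd_term_eq' ρ d m α β r₁ s₁ r₂ s₂
    have hnorm : ∀ (x : ℕ → ℕ → ℂ),
        ∑ r ∈ Ioc (R / N) (2 * R / N), ∑ s ∈ Ioc S (2 * S),
            ‖(fun r s => if ρ ∣ r then x r s else 0) r s‖ ^ 2 =
          ∑ r ∈ Ioc (R / N) B, (if ρ ∣ r then ∑ s ∈ Ioc S (2 * S), ‖x r s‖ ^ 2 else 0) := by
      intro x
      refine sum_congr rfl fun r _ => ?_
      by_cases hr : ρ ∣ r
      · simp only [if_pos hr]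
      · simp [if_neg hr]
    rw [hnorm α, hnorm β] at key
    have hqY : ((R / N : ℕ) : ℝ) ≤ X := by rw [hX]; exact Nat.cast_div_le
    have hflat := flat_two_boxes_le (m := m) (D := D) (S := S) hε.le hε1 hqY le_rfl
    have hsq0 : 0 ≤ Real.sqrt (a ρ) * Real.sqrt (b ρ) := mul_nonneg (Real.sqrt_nonneg _) (Real.sqrt_nonneg _)
    have hC8 : 0 ≤ 8 * C := by positivity
    calc ∑ d ∈ Ioc D (2 * D), ‖F ρ d‖ = _ := sum_congr rfl fun d _ => by rw [hFeq d]
      _ ≤ _ := key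
      _ ≤ 8 * C * (3 * (X * S / Real.sqrt ((m : ℝ) * D)) + 5 * T) *
            (Real.sqrt (a ρ) * Real.sqrt (b ρ)) := by
          apply mul_le_mul_of_nonneg_right _ hsq0
          exact mul_le_mul_of_nonneg_left hflat hC8
      _ = 8 * C * (3 * A + 5 * T) * (Real.sqrt (a ρ) * Real.sqrt (b ρ)) := by rw [hA]
  /- Step 1: Möbius inversion and the triangle inequality. -/
  have hstep1 : ∑ d ∈ Ioc D (2 * D), ‖∑ r₁ ∈ Ioc (R / N) (2 * R / N), ∑ s₁ ∈ Ioc S (2 * S),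
        ∑ r₂ ∈ Ioc (R / N) (2 * R / N), ∑ s₂ ∈ Ioc S (2 * S),
        (if ((d * m : ℕ) : ℤ) ∣ (r₁ : ℤ) * s₂ - (r₂ : ℤ) * s₁ ∧ r₁.Coprime r₂ then
          α r₁ s₁ * conj (β r₂ s₂) * (J((d : ℤ) | r₁ * r₂) : ℂ) else 0)‖ ≤
      ∑ ρ ∈ Icc 1 B, ∑ d ∈ Ioc D (2 * D), ‖F ρ d‖ := by
    calc _ = ∑ d ∈ Ioc D (2 * D), ‖∑ ρ ∈ Icc 1 B, (μ ρ : ℂ) * F ρ d‖ :=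
          sum_congr rfl fun d _ => by rw [bilinearCoprime_eq_sum_moebius' m d (R / N) B S α β]
      _ ≤ ∑ d ∈ Ioc D (2 * D), ∑ ρ ∈ Icc 1 B, ‖(μ ρ : ℂ) * F ρ d‖ :=
          sum_le_sum fun d _ => norm_sum_le _ _
      _ ≤ ∑ d ∈ Ioc D (2 * D), ∑ ρ ∈ Icc 1 B, ‖F ρ d‖ := by
          refine sum_le_sum fun d _ => sum_le_sum fun ρ _ => ?_
          rw [norm_mul]
          have hμ : ‖(μ ρ : ℂ)‖ ≤ 1 := by
            rw [Complex.norm_intCast]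
            exact_mod_cast ArithmeticFunction.abs_moebius_le_one
          exact mul_le_of_le_one_left (norm_nonneg _) hμ
      _ = ∑ ρ ∈ Icc 1 B, ∑ d ∈ Ioc D (2 * D), ‖F ρ d‖ := sum_comm
  /- Step 2: split the `ρ`-sum and use the two cases. -/
  set Pa := (Icc 1 B).filter (fun ρ => N * ρ ≤ R) with hPa
  set Pb := (Icc 1 B).filter (fun ρ => ¬N * ρ ≤ R) with hPb
  have hsplit : ∑ ρ ∈ Icc 1 B, ∑ d ∈ Ioc D (2 * D), ‖F ρ d‖ =
      ∑ ρ ∈ Pa, ∑ d ∈ Ioc D (2 * D), ‖F ρ d‖ + ∑ ρ ∈ Pb, ∑ d ∈ Ioc D (2 * D), ‖F ρ d‖ :=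
    (sum_filter_add_sum_filter_not _ _ _).symm
  -- (a): harmonic sum against the plain norms, Cauchy–Schwarz against the τ-norms
  have hPa_sub : Pa ⊆ Icc 1 (R / N) := by
    intro ρ hρ
    rw [hPa, mem_filter, mem_Icc] at hρ
    rw [mem_Icc]
    exact ⟨hρ.1.1, (Nat.le_div_iff_mul_le hN0).2 (by rw [mul_comm]; exact hρ.2)⟩
  have hharm : ∑ ρ ∈ Pa, (ρ : ℝ)⁻¹ ≤ 1 + Real.log R := by
    calc ∑ ρ ∈ Pa, (ρ : ℝ)⁻¹ ≤ ∑ ρ ∈ Icc 1 (R / N), (ρ : ℝ)⁻¹ :=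
          sum_le_sum_of_subset_of_nonneg hPa_sub fun ρ _ _ => by positivity
      _ ≤ 1 + Real.log ((R / N : ℕ) : ℝ) := sum_Icc_inv_le_log' _ hq₀
      _ ≤ 1 + Real.log R := by
          have h0 : (0 : ℝ) < ((R / N : ℕ) : ℝ) := by exact_mod_cast hq₀
          have h1 : ((R / N : ℕ) : ℝ) ≤ (R : ℝ) := by exact_mod_cast Nat.div_le_self R N
          linarith [Real.log_le_log h0 h1]
  have hsumA : ∑ ρ ∈ Pa, ∑ d ∈ Ioc D (2 * D), ‖F ρ d‖ ≤
      24 * C * A * (1 + Real.log R) * (Real.sqrt nα * Real.sqrt nβ) +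
        40 * C * T * (Real.sqrt tα * Real.sqrt tβ) := by
    have h1 : ∑ ρ ∈ Pa, ∑ d ∈ Ioc D (2 * D), ‖F ρ d‖ ≤
        ∑ ρ ∈ Pa, (24 * C * A * (ρ : ℝ)⁻¹ * (Real.sqrt nα * Real.sqrt nβ) +
          40 * C * T * (Real.sqrt (a ρ) * Real.sqrt (b ρ))) := by
      refine sum_le_sum fun ρ hρ => ?_
      have hρ' := hρ
      rw [hPa, mem_filter] at hρ'
      refine (hcaseA ρ hρ'.1 hρ'.2).trans ?_
      have hsq : Real.sqrt (a ρ) * Real.sqrt (b ρ) ≤ Real.sqrt nα * Real.sqrt nβ :=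
        mul_le_mul (Real.sqrt_le_sqrt (ha_le ρ)) (Real.sqrt_le_sqrt (hb_le ρ))
          (Real.sqrt_nonneg _) (Real.sqrt_nonneg _)
      have hρ0 : (0 : ℝ) < ρ := by rw [mem_Icc] at hρ'; exact_mod_cast hρ'.1.1
      have h24 : 0 ≤ 24 * C * A * (ρ : ℝ)⁻¹ := by positivity
      calc 8 * C * (3 * (A / ρ) + 5 * T) * (Real.sqrt (a ρ) * Real.sqrt (b ρ))
          = 24 * C * A * (ρ : ℝ)⁻¹ * (Real.sqrt (a ρ) * Real.sqrt (b ρ)) +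
              40 * C * T * (Real.sqrt (a ρ) * Real.sqrt (b ρ)) := by rw [div_eq_mul_inv]; ring
        _ ≤ _ := by gcongr
    have hcs : ∑ ρ ∈ Pa, Real.sqrt (a ρ) * Real.sqrt (b ρ) ≤ Real.sqrt tα * Real.sqrt tβ := by
      calc ∑ ρ ∈ Pa, Real.sqrt (a ρ) * Real.sqrt (b ρ)
          ≤ Real.sqrt (∑ ρ ∈ Pa, a ρ) * Real.sqrt (∑ ρ ∈ Pa, b ρ) :=
            Real.sum_sqrt_mul_sqrt_le _ ha0 hb0
        _ ≤ Real.sqrt (∑ ρ ∈ Icc 1 B, a ρ) * Real.sqrt (∑ ρ ∈ Icc 1 B, b ρ) :=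
            mul_le_mul
              (Real.sqrt_le_sqrt
                (sum_le_sum_of_subset_of_nonneg (filter_subset _ _) fun ρ _ _ => ha0 ρ))
              (Real.sqrt_le_sqrt
                (sum_le_sum_of_subset_of_nonneg (filter_subset _ _) fun ρ _ _ => hb0 ρ))
              (Real.sqrt_nonneg _) (Real.sqrt_nonneg _)
        _ = Real.sqrt tα * Real.sqrt tβ := by rw [ha_sum, hb_sum]
    have h24' : 0 ≤ 24 * C * A := by positivity
    have h40 : 0 ≤ 40 * C * T := by positivity
    have hnn : 0 ≤ Real.sqrt nα * Real.sqrt nβ := mul_nonneg (Real.sqrt_nonneg _) (Real.sqrt_nonneg _)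
    refine h1.trans ?_
    rw [sum_add_distrib, ← sum_mul, ← mul_sum, ← mul_sum]
    have := mul_le_mul_of_nonneg_left hharm h24'
    nlinarith [mul_le_mul_of_nonneg_left hcs h40, mul_le_mul_of_nonneg_right this hnn]
  -- (b): only `r = ρ` contributes; one Cauchy–Schwarz
  have hab_b : ∀ ρ ∈ Pb, a ρ = (if ρ ∈ Ioc (R / N) B then gα ρ else 0) ∧
      b ρ = (if ρ ∈ Ioc (R / N) B then gβ ρ else 0) := by
    intro ρ hρ
    rw [hPb, mem_filter] at hρ
    have heq : ∀ (g : ℕ → ℝ), (∑ r ∈ Ioc (R / N) B, if ρ ∣ r then g r else 0) =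
        ∑ r ∈ Ioc (R / N) B, if ρ = r then g r else 0 := by
      intro g
      refine sum_congr rfl fun r hr => ?_
      by_cases hdvd : ρ ∣ r
      · rw [if_pos hdvd, if_pos (eq_of_dvd_of_mem_box hρ.2 hr hdvd).symm]
      · rw [if_neg hdvd, if_neg]
        rintro rfl
        exact hdvd dvd_rfl
    refine ⟨?_, ?_⟩
    · simp only [ha]; rw [heq, sum_ite_eq]
    · simp only [hb]; rw [heq, sum_ite_eq]
  have hsumPb : ∀ (g : ℕ → ℝ), (∀ r, 0 ≤ g r) →
      ∑ ρ ∈ Pb, (if ρ ∈ Ioc (R / N) B then g ρ else 0) ≤ ∑ r ∈ Ioc (R / N) B, g r := by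
    intro g hg
    rw [← sum_filter]
    exact sum_le_sum_of_subset_of_nonneg (fun ρ hρ => (mem_filter.1 hρ).2) fun r _ _ => hg r
  have hsumB : ∑ ρ ∈ Pb, ∑ d ∈ Ioc D (2 * D), ‖F ρ d‖ ≤
      8 * C * (3 * A + 5 * T) * (Real.sqrt nα * Real.sqrt nβ) := by
    calc ∑ ρ ∈ Pb, ∑ d ∈ Ioc D (2 * D), ‖F ρ d‖
        ≤ ∑ ρ ∈ Pb, 8 * C * (3 * A + 5 * T) * (Real.sqrt (a ρ) * Real.sqrt (b ρ)) :=
          sum_le_sum fun ρ hρ => by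
            have hρ' := hρ
            rw [hPb, mem_filter] at hρ'
            exact hcaseB ρ hρ'.1 hρ'.2
      _ = 8 * C * (3 * A + 5 * T) * ∑ ρ ∈ Pb, Real.sqrt (a ρ) * Real.sqrt (b ρ) := by
          rw [mul_sum]
      _ ≤ 8 * C * (3 * A + 5 * T) * (Real.sqrt (∑ ρ ∈ Pb, a ρ) * Real.sqrt (∑ ρ ∈ Pb, b ρ)) := by
          gcongr
          exact Real.sum_sqrt_mul_sqrt_le _ ha0 hb0
      _ ≤ 8 * C * (3 * A + 5 * T) * (Real.sqrt nα * Real.sqrt nβ) := by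
          gcongr
          · calc ∑ ρ ∈ Pb, a ρ = ∑ ρ ∈ Pb, (if ρ ∈ Ioc (R / N) B then gα ρ else 0) :=
                  sum_congr rfl fun ρ hρ => (hab_b ρ hρ).1
              _ ≤ nα := hsumPb gα hgα0
          · calc ∑ ρ ∈ Pb, b ρ = ∑ ρ ∈ Pb, (if ρ ∈ Ioc (R / N) B then gβ ρ else 0) :=
                  sum_congr rfl fun ρ hρ => (hab_b ρ hρ).2
              _ ≤ nβ := hsumPb gβ hgβ0
  /- Step 3: assembly. -/
  have hlog := two_add_log_le hR
  have hlog0 : 0 ≤ Real.log (2 * R) := Real.log_nonneg (by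
    have : (1 : ℝ) ≤ R := by exact_mod_cast hR
    linarith)
  have hnn : 0 ≤ Real.sqrt nα * Real.sqrt nβ := mul_nonneg (Real.sqrt_nonneg _) (Real.sqrt_nonneg _)
  have htt : Real.sqrt nα * Real.sqrt nβ ≤ Real.sqrt tα * Real.sqrt tβ :=
    mul_le_mul (Real.sqrt_le_sqrt hnt_α) (Real.sqrt_le_sqrt hnt_β) (Real.sqrt_nonneg _)
      (Real.sqrt_nonneg _)
  have htt0 : 0 ≤ Real.sqrt tα * Real.sqrt tβ := mul_nonneg (Real.sqrt_nonneg _) (Real.sqrt_nonneg _)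
  -- (`set` has already rewritten the goal in terms of `A`, `T`, `nα`, `nβ`, `tα`, `tβ`)
  calc _ ≤ ∑ ρ ∈ Icc 1 B, ∑ d ∈ Ioc D (2 * D), ‖F ρ d‖ := hstep1
    _ = _ := hsplit
    _ ≤ 24 * C * A * (1 + Real.log R) * (Real.sqrt nα * Real.sqrt nβ) +
          40 * C * T * (Real.sqrt tα * Real.sqrt tβ) +
          8 * C * (3 * A + 5 * T) * (Real.sqrt nα * Real.sqrt nβ) := add_le_add hsumA hsumB
    _ = 24 * C * A * (2 + Real.log R) * (Real.sqrt nα * Real.sqrt nβ) +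
          40 * C * T * (Real.sqrt tα * Real.sqrt tβ) +
          40 * C * T * (Real.sqrt nα * Real.sqrt nβ) := by ring
    _ ≤ 24 * C * A * (3 * Real.log (2 * R)) * (Real.sqrt nα * Real.sqrt nβ) +
          40 * C * T * (Real.sqrt tα * Real.sqrt tβ) +
          40 * C * T * (Real.sqrt tα * Real.sqrt tβ) := by
        have h24 : 0 ≤ 24 * C * A := by positivity
        have h40 : 0 ≤ 40 * C * T := by positivity
        nlinarith [mul_le_mul_of_nonneg_left hlog h24, mul_le_mul_of_nonneg_left htt h40,
          mul_nonneg (mul_nonneg h24 hlog0) hnn]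
    _ ≤ 80 * C * (A * Real.log (2 * R) * (Real.sqrt nα * Real.sqrt nβ) +
          T * (Real.sqrt tα * Real.sqrt tβ)) := by
        nlinarith [mul_nonneg (mul_nonneg (mul_nonneg hC.le hA0) hlog0) hnn]

end Literature.NumberTheory.Sieve.FriedlanderIwaniecPrimes

end
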